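import Mathlib
import HarnessLib
import Summits.QuantumFields.Statement
import Summits.QuantumFields.QCD.Theses.QuarksAsStableAction
import Summits.QuantumFields.QCD.Theses.WilsonQuarkChessboard

/-!
# Sketch — first lemmas for crux ideas on `QuarksAsStableAction.CriticalLineDiamagnetism`
(stmt-QuantumFields-9734), planner-cruxidea-stmt-QuantumFields-9734-1-0, round 1, ideator 1.

Nothing here is proved. Every `def … : Prop` is a candidate FIRST LEMMA / transfer target of a
line, stated over existing declarations only (`wilsonDirac`, `fermionDet`, `unitaryFundamentalRep`,
`fundamentalRep`, `plaquetteHolonomy`, `GaugeConfig`, `Site.shift`, the two route files).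

* card `chessboard-coercive-cell`:  `CoercivePeriodTwo` (= the crux restricted to period-2
  reflection tilings, with `K = 0`), `CellCounting` (exact bookkeeping identity),
  `CriticalLineDiamagnetismEven`, `ChessboardTransfer`.
* card `wilson-flow-h-theorem`:     `linkPlaqSum`, `gradS` (the su(3)-gradient of `S_W`),
  `FlowAlignment` (infinitesimal H-theorem), `CriticalSetBound`, `FlowTransfer`.
-/

namespace Summit.QuantumFields.QCD.Cruxes.CriticalLineDiamagnetism.SketchIdeator1

open scoped BigOperators Matrix ComplexConjugate Classical
open Literature.MathematicalPhysics.QuantumLattice Literature.MathematicalPhysics.QuantumFieldTheory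

/-- Shorthand for the gauge groups. -/
abbrev SU3 : Type := Matrix.specialUnitaryGroup (Fin 3) ℂ
/-- Shorthand for the gauge groups. -/
abbrev U3 : Type := Matrix.unitaryGroup (Fin 3) ℂ

/-- The `U(3)`-lift of an `SU(3)` configuration with the antiperiodic seam of the crux
(links leaving the slice `x_μ = -1` sign-flipped) — verbatim the crux's inlined term. -/
def apLift {L : ℕ} [NeZero L] (U : GaugeConfig 4 L SU3) : GaugeConfig 4 L U3 :=
  fun e => if e.1 e.2 = -1
    then -(⟨(U e).1, Matrix.specialUnitaryGroup_le_unitaryGroup (U e).2⟩ : U3)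
    else ⟨(U e).1, Matrix.specialUnitaryGroup_le_unitaryGroup (U e).2⟩

/-- `apDet U m = det D_AP[U, m]` (r = 1), the crux's `apDet`. -/
noncomputable def apDet {L : ℕ} [NeZero L] (U : GaugeConfig 4 L SU3) (m : ℝ) : ℂ :=
  fermionDet (wilsonDirac (unitaryFundamentalRep (Fin 3) ℂ) (apLift U) m 1)

/-- Plaquette deficit `3 − Re tr U_p`, the crux's `dfc`. -/
noncomputable def dfc {L : ℕ} [NeZero L] (U : GaugeConfig 4 L SU3) (p : Plaquette 4 L) : ℝ :=
  3 - (fundamentalRep (Fin 3) (plaquetteHolonomy U p.1 p.2.1.1 p.2.1.2)).trace.re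

/-- `S_good(U) = Σ_{deficit < δ} deficit`. -/
noncomputable def Sgood {L : ℕ} [NeZero L] (δ : ℝ) (U : GaugeConfig 4 L SU3) : ℝ :=
  ∑ p ∈ Finset.univ.filter (fun p => dfc U p < δ), dfc U p

/-- `N_bad(U) = #{deficit ≥ δ}`. -/
noncomputable def Nbad {L : ℕ} [NeZero L] (δ : ℝ) (U : GaugeConfig 4 L SU3) : ℝ :=
  ((Finset.univ.filter (fun p => δ ≤ dfc U p)).card : ℝ)

/-- The crux restricted to EVEN tori (same constants, same shape). The crux itself is
`CriticalLineDiamagnetismEven ∧ (odd-L analogue)`; the chessboard line reaches only this half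
(the route's engine `UnquenchedChessboardBound` is itself even-L). -/
def CriticalLineDiamagnetismEven : Prop :=
  ∃ ε δ c₁ K C : ℝ, 0 < ε ∧ 0 < δ ∧ 0 < c₁ ∧ ∃ L₀ : ℕ, ∀ (L : ℕ) [NeZero L], Even L → L₀ ≤ L →
    ∀ m : ℝ, |m| ≤ ε → ∀ U : GaugeConfig 4 L SU3,
      ‖apDet U m‖ ≤ Real.exp (K - c₁ * Sgood δ U + C * Nbad δ U) * ‖apDet (L := L) 1 m‖

/-! ## Card `chessboard-coercive-cell` -/

/-- The all-axes antiperiodic Wilson determinant of a `U(3)` field, verbatim the `dAP` of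
`WilsonQuarkChessboard.QuarkChessboard` at `N = 3` (seam convention `(x_i).val + 1 = L`). -/
noncomputable def dAP3 {L : ℕ} [NeZero L] (V : GaugeConfig 4 L U3) (m : ℝ) : ℂ :=
  (wilsonDirac (unitaryFundamentalRep (Fin 3) ℂ)
    (fun e => if (e.1 e.2).val + 1 = L then -V e else V e) m 1).det

/-- The period-2 reflection tiling of the torus by the closed unit cell with lowest corner `c`,
verbatim the `tile` of `WilsonQuarkChessboard.QuarkChessboard`. -/
def tile {L : ℕ} [NeZero L] (c : Site 4 L) (V : GaugeConfig 4 L U3) : GaugeConfig 4 L U3 :=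
  fun e => if (e.1 e.2 - c e.2).val % 2 = 0
    then V (fun ν => c ν + (((e.1 ν - c ν).val % 2 : ℕ) : ZMod L), e.2)
    else (V (fun ν => c ν + (((Site.shift e.1 e.2 ν - c ν).val % 2 : ℕ) : ZMod L), e.2))⁻¹

/-- Plaquette deficit of a `U(3)` field. -/
noncomputable def dfc3 {L : ℕ} [NeZero L] (V : GaugeConfig 4 L U3) (p : Plaquette 4 L) : ℝ :=
  3 - (unitaryFundamentalRep (Fin 3) ℂ (plaquetteHolonomy V p.1 p.2.1.1 p.2.1.2)).trace.re

/-- **Transfer target C⁺ of card `chessboard-coercive-cell`** — the crux RESTRICTED TO PERIOD-2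
REFLECTION TILINGS, with no finite-volume constant (`K = 0`): there are `ε, δ, c₁ > 0`, `C`, `L₀`
such that for every even `L ≥ L₀`, `|m| ≤ ε`, every `U(3)` field `V` and every cell `c`,
`Re det_AP[R_c V] ≤ exp(C·N_bad(R_c V) − c₁·S_good(R_c V)) · Re det_AP[𝟙]`.
By Bloch–Floquet the left side is a product over the `(L/2)⁴` antiperiodic momenta of `192 × 192`
determinants depending on the 32 cell links: a finite-dimensional family. Near the flat cell the
claim is one-loop positivity at the reflection-even momenta (refuter scan: `≥ 0.00635·S_W`);
away from it, strict `FlatCellOptimal` plus COMPACTNESS of `U(3)^32` gives the linear gain. -/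
def CoercivePeriodTwo : Prop :=
  ∃ ε δ c₁ C : ℝ, 0 < ε ∧ 0 < δ ∧ 0 < c₁ ∧ ∃ L₀ : ℕ, ∀ (L : ℕ) [NeZero L], Even L → L₀ ≤ L →
    ∀ m : ℝ, |m| ≤ ε → ∀ (V : GaugeConfig 4 L U3) (c : Site 4 L),
      (dAP3 (tile c V) m).re ≤
        Real.exp (C * ((Finset.univ.filter (fun p => δ ≤ dfc3 (tile c V) p)).card : ℝ)
            - c₁ * (∑ p ∈ Finset.univ.filter (fun p => dfc3 (tile c V) p < δ), dfc3 (tile c V) p))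
          * (dAP3 (L := L) 1 m).re

/-- **Cell counting (exact bookkeeping, provable now).** Averaged over the `L⁴` cells, any
function of the plaquette deficits of the tiling `R_c V` reproduces the same function summed over
the plaquettes of `V`: each of the 24 plaquettes of the closed cell `c` appears `L⁴/4` times in
`R_c V` (reflected copies have the same deficit), and each plaquette of the torus lies in exactly
4 closed unit cells. Consequence: `(1/L⁴) Σ_c S_good(R_c V) = S_good(V)` and
`(1/L⁴) Σ_c N_bad(R_c V) = N_bad(V)` — the chessboard exponent `1/L⁴` is exactly absorbed. -/
def CellCounting : Prop :=
  ∀ (L : ℕ) [NeZero L], Even L → 4 ≤ L → ∀ (V : GaugeConfig 4 L U3) (g : ℝ → ℝ),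
    ∑ c : Site 4 L, ∑ q : Plaquette 4 L, g (dfc3 (tile c V) q) =
      (L : ℝ) ^ 4 * ∑ p : Plaquette 4 L, g (dfc3 V p)

/-- **Glue of card `chessboard-coercive-cell`**: the sibling route's engine
`QuarkChessboard` (stmt-QuantumFields-9306, UNPROVED) at `N = 3`, applied to the lift `apLift U`
(an honest `U(3)` field; the two seam conventions `x_i = -1` / `(x_i).val + 1 = L` agree), the
cell bound `CoercivePeriodTwo`, and `CellCounting`, give the even-L crux with `K = 0`:
`L⁴·log‖det U‖ ≤ Σ_c [log Re det(R_c U)] ≤ L⁴ log det 𝟙 + Σ_c [C·N_bad(R_c) − c₁·S_good(R_c)]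
 = L⁴ [log det 𝟙 + C·N_bad(U) − c₁·S_good(U)]`. -/
def ChessboardTransfer : Prop :=
  Theses.WilsonQuarkChessboard.QuarkChessboard → CoercivePeriodTwo → CellCounting →
    CriticalLineDiamagnetismEven

/-! ## Card `wilson-flow-h-theorem` -/

/-- The sum of the six plaquettes through the link `e = (x, μ)`, each opened at `x` and starting
with `U(x,μ)`: `M_e = Σ_{ν ≠ μ} [U_{x;μν} + U(x−ν̂,ν)⁻¹ · U_{x−ν̂;νμ} · U(x−ν̂,ν)]`, so that
`Σ_{p ∋ e} Re tr U_p = Re tr M_e` and `M_e = U_e · (staple sum)`. -/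
noncomputable def linkPlaqSum {L : ℕ} [NeZero L] (U : GaugeConfig 4 L SU3) (e : Edge 4 L) :
    Matrix (Fin 3) (Fin 3) ℂ :=
  ∑ ν ∈ Finset.univ.filter (fun ν => ν ≠ e.2),
    (fundamentalRep (Fin 3) (plaquetteHolonomy U e.1 e.2 ν) +
      fundamentalRep (Fin 3)
        ((U (e.1 - Pi.single ν 1, ν))⁻¹ * plaquetteHolonomy U (e.1 - Pi.single ν 1) ν e.2 *
          U (e.1 - Pi.single ν 1, ν)))

/-- The `su(3)`-gradient of the Wilson action at the link `e` for the inner product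
`⟨Y, Z⟩ = Re tr (Yᴴ Z)`: the traceless anti-Hermitian part of `M_e`. Along
`U_e ↦ exp(tY) U_e`, `Y ∈ su(3)`: `d/dt S_W = ⟨Y, gradS U e⟩`; steepest descent has link
velocity `−gradS U e · U_e` (the Wilson / gradient flow at the lattice scale). -/
noncomputable def gradS {L : ℕ} [NeZero L] (U : GaugeConfig 4 L SU3) (e : Edge 4 L) :
    Matrix (Fin 3) (Fin 3) ℂ :=
  (1 / 2 : ℂ) • (linkPlaqSum U e - (linkPlaqSum U e)ᴴ) -
    ((1 / 6 : ℂ) * (linkPlaqSum U e - (linkPlaqSum U e)ᴴ).trace) • (1 : Matrix (Fin 3) (Fin 3) ℂ)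

/-- **First lemma of card `wilson-flow-h-theorem` (infinitesimal H-theorem / force alignment).**
There are `ε, δ, c₁ > 0` and `L₀` such that for every torus `L ≥ L₀`, `|m| ≤ ε`, every ALL-GOOD
field `U` (all deficits `< δ`) with `det D_AP[U,m] ≠ 0`, and every differentiable one-parameter
family `V` through `U` whose link velocities at `t = 0` are the steepest-descent velocities of
`S_W`, the log-determinant increases at least at rate `c₁ ‖∇S_W(U)‖²`:
`c₁ · Σ_e ‖gradS U e‖_F² ≤ d/dt|₀ log |det D_AP[V t, m]|`.
Equivalently: the quark-induced link current is ALIGNED with the staple force,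
`⟨∂ log|det|, −∇S_W⟩ ≥ c₁ ‖∇S_W‖²` — so `t ↦ log|det D_AP[U_t]| + c₁ S_W(U_t)` is
non-decreasing along the Wilson flow while the field stays good. One-loop: the rate is the
polarisation ratio `R(q) ≥ 0.00635`; kit j016930: ratio `0.004–0.011 > 0` on random fields. -/
def FlowAlignment : Prop :=
  ∃ ε δ c₁ : ℝ, 0 < ε ∧ 0 < δ ∧ 0 < c₁ ∧ ∃ L₀ : ℕ, ∀ (L : ℕ) [NeZero L], L₀ ≤ L →
    ∀ m : ℝ, |m| ≤ ε → ∀ U : GaugeConfig 4 L SU3, (∀ p, dfc U p < δ) → apDet U m ≠ 0 →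
      ∀ V : ℝ → GaugeConfig 4 L SU3, V 0 = U →
        (∀ e : Edge 4 L,
          HasDerivAt (fun t => ((V t e).1 : Matrix (Fin 3) (Fin 3) ℂ))
            (-(gradS U e * ((U e).1 : Matrix (Fin 3) (Fin 3) ℂ))) 0) →
        c₁ * (∑ e : Edge 4 L, ∑ i : Fin 3, ∑ j : Fin 3, ‖gradS U e i j‖ ^ 2) ≤
          deriv (fun t => Real.log ‖apDet (V t) m‖) 0

/-- **Second stub of the flow line (the ω-limit set).** The crux ON THE CRITICAL SET of the Wilson
action restricted to all-good fields: for every all-good `U` with `∇S_W(U) = 0` (flat connections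
in all holonomy sectors, constant abelian and non-abelian fluxes, lattice saddles) the crux
inequality holds with `N_bad = 0`. These configurations are homogeneous/exactly reducible
(theta-function monotonicity for flat twists; magnetic Bloch reduction for constant flux — kit
j000841 PART B and j016993 PART 3), which is why the flow is worth running TO them. -/
def CriticalSetBound : Prop :=
  ∃ ε δ c₁ K : ℝ, 0 < ε ∧ 0 < δ ∧ 0 < c₁ ∧ ∃ L₀ : ℕ, ∀ (L : ℕ) [NeZero L], L₀ ≤ L →
    ∀ m : ℝ, |m| ≤ ε → ∀ U : GaugeConfig 4 L SU3, (∀ p, dfc U p < δ) → (∀ e, gradS U e = 0) →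
      ‖apDet U m‖ ≤ Real.exp (K - c₁ * ∑ p : Plaquette 4 L, dfc U p) * ‖apDet (L := L) 1 m‖

/-- **Glue claim of card `wilson-flow-h-theorem`** (the remaining two inputs are named in the
card: monotonicity of `|det|` through bad epochs of the flow — zero-mode LIFTING when a lattice
instanton falls through — and the O(1)-per-dislocation defect pricing shared by every line):
`FlowAlignment → CriticalSetBound → (bad-epoch monotonicity) → (defect pricing) → crux`.
Stated here only as the implication skeleton over the two typed stubs. -/
def FlowTransfer : Prop :=
  FlowAlignment → CriticalSetBound → Theses.QuarksAsStableAction.CriticalLineDiamagnetism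

end Summit.QuantumFields.QCD.Cruxes.CriticalLineDiamagnetism.SketchIdeator1

/-! ## Sanity: the even-L restatement is literally the crux with `Even L` inserted -/

namespace Summit.QuantumFields.QCD.Cruxes.CriticalLineDiamagnetism.SketchIdeator1

/-- The crux implies its even-L half by definitional unfolding of the shorthands
(`apDet`, `apLift`, `dfc`, `Sgood`, `Nbad` are the crux's inlined terms). -/
example : Theses.QuarksAsStableAction.CriticalLineDiamagnetism → CriticalLineDiamagnetismEven := by
  rintro ⟨ε, δ, c₁, K, C, hε, hδ, hc, L₀, h⟩
  refine ⟨ε, δ, c₁, K, C, hε, hδ, hc, L₀, ?_⟩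
  intro L _ _ hL m hm U
  exact h L hL m hm U

end Summit.QuantumFields.QCD.Cruxes.CriticalLineDiamagnetism.SketchIdeator1
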